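import Literature.Barriers.CriticalPhenomena.LaceExpansionIsingAboveFourOpenFacts
import HarnessLib

/-!
# Sakai's Theorem 1.3 (spread-out Ising, `d > 4`) assembled from its three open inputs

Barrier catalogue `Literature/Barriers/CriticalPhenomena/` (D-0021), a one-theorem bookkeeping
file (fact decomposition, librarian 2026-08-16) for the named fact
`Literature.Barriers.CriticalPhenomena.SpreadOutIsing.Sakai2007_thm13_spreadOut`
(`LaceExpansionIsingAboveFour.lean`; A. Sakai, *Lace expansion for the Ising model*, Comm. Math.
Phys. 272 (2007), Thm. 1.3: Gaussian infrared asymptotics of the critical two-point function of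
the spread-out Ising model above four dimensions).

The tree has joined the analysis line and the expansion line of the printed proof
(`LaceExpansionIsingAboveFourOpenFacts.lean`, `Sakai2007_thm13_spreadOut_of_open_facts`): Thm. 1.3
follows from

* `LiuSlade2026_thm22` — Liu–Slade's Gaussian deconvolution theorem, uniform in the spread-out
  parameter `L` (Ann. IHP Probab. Stat. 62 (2026), Thm. 2.2);
* `LiuSlade2024_thm12_critical` — the critical sharp-error version (PTRF 195 (2024), Thm. 1.2);
* `Sakai2007_prop31` — Sakai's diagrammatic bounds on the lace-expansion coefficients (op. cit.
  Prop. 3.1, with the corrected bounds of Sakai 2022),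

Sakai's Proposition 1.1 (the expansion itself) being PROVED in the tree by the random-current
representation (`IsingLace.Sakai2007_prop11_holds`). This file records that edge under the
decomposition name `Sakai2007_thm13_spreadOut_holds_of`, whose hypotheses are exactly the three
children; no definition, no new named fact, nothing restated.

## References

* A. Sakai, Comm. Math. Phys. 272 (2007) 283–344, Thm. 1.3, Props. 1.1, 3.1. [Sakai2007]
* A. Sakai, Comm. Math. Phys. 392 (2022) 783–823 (corrected coefficient bounds). [Sakai2022]
* Y. Liu, G. Slade, Ann. Inst. H. Poincaré Probab. Statist. 62 (2026), Thm. 2.2. [LiuSlade2026]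
* Y. Liu, G. Slade, Probab. Theory Related Fields 195 (2024), Thm. 1.2. [LiuSlade2024]
-/

noncomputable section

namespace Literature.Barriers.CriticalPhenomena

namespace SpreadOutIsing

/-- **`Sakai2007_thm13_spreadOut` from its three children**: Liu–Slade 2026, Thm. 2.2
(`LiuSlade2026_thm22`), Liu–Slade 2024, Thm. 1.2 in the critical case
(`LiuSlade2024_thm12_critical`) and Sakai 2007, Prop. 3.1 (`Sakai2007_prop31`) imply Sakai's
Theorem 1.3 for the spread-out Ising model in `d > 4` — the tree's
`Sakai2007_thm13_spreadOut_of_open_facts` (`LaceExpansionIsingAboveFourOpenFacts.lean`), Prop. 1.1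
being proved there from random currents. [cite: Sakai2007, Theorem 1.3] -/
theorem Sakai2007_thm13_spreadOut_holds_of (h22 : LiuSlade2026_thm22)
    (h12 : LiuSlade2024_thm12_critical) (h31 : Sakai2007_prop31) : Sakai2007_thm13_spreadOut :=
  Sakai2007_thm13_spreadOut_of_open_facts h22 h12 h31

end SpreadOutIsing

end Literature.Barriers.CriticalPhenomena

end
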